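import Mathlib.Data.Nat.ModEq
import Mathlib.Algebra.Ring.Parity
import Mathlib.Algebra.Order.Ring.Canonical
import Mathlib.Algebra.Group.Nat.Even
import Mathlib.Tactic.Linarith
import Mathlib.Tactic.Positivity
import Mathlib.Tactic.Ring
import Mathlib.Tactic.NormNum
import HarnessLib

/-!
# Khare–Wintenberger, *Serre's modularity conjecture (I)*, §8.2: the choice of the exponent `i`

Topic `Literature/NumberTheory/Automorphic`; companion of `KhareWintenbergerPrimeEstimates.lean`
(§7 of Khare–Wintenberger (I), Invent. Math. 178 (2009): the estimates (1)–(4) on the next prime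
`P` after a prime `p ≥ 5`) and of `SerreConjecture.lean`.  Pure proof file, elementary
arithmetic only, no named facts.

In the inductive step of the proof of Theorem 3.2 (op. cit. §8.2, residue characteristic `P` =
the next prime after `p ≥ 5`, `ℓ^r ∥ P − 1` chosen by §7) Khare–Wintenberger lift a mod `ℓ`
representation by their Theorem 5.1 (3), "choosing `χ' = ω_P^i` with
`i ∈ [ (m/(2m+1))(P−1), ((m+1)/(2m+1))(P−1) ]` when `ℓ > 2` (`ℓ = 2m+1`), and an even
`i ∈ [ (1/2)(P−1), ((2^{r−1}+2)/2^r)(P−1) ]` when `ℓ = 2`", the character `χ' = ω_P^i`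
(`0 < i ≤ P − 2`, `i` even if `ℓ = 2`) having to reduce modulo `ℓ` to a prescribed character,
i.e. `i` having to lie in a prescribed residue class modulo `(P − 1)/ℓ^r` (the order of the
reduction of `ω_P`); and then "by choice of `i`, the estimates (3) and (4) of Section 7, and
Theorem 5.1 (3)" — which gives Serre weight `i + 2` or `P + 1 − i` — "we deduce that (after
twisting by a suitable power of `χ_P`) `k(ρ̄'_P) ≤ p + 1`".  This file proves exactly the
arithmetic content of that sentence:

* `exists_modEq_mem_Icc`, `exists_even_modEq_mem_Icc` — a residue class modulo `M` meets every
  run of `M` consecutive naturals; for `M` odd, an even member of the class in every run of `2M`;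
* `exists_exponent_odd` (`ℓ = 2m+1 > 2`) and `exists_exponent_two` (`ℓ = 2`, `r ≥ 4`): under
  estimate (3), resp. (4), of §7 in the integer-cleared form of
  `KhareWintenbergerPrimeEstimates.sec7_int`, the printed interval contains an `i` of any
  prescribed class modulo `M = (P−1)/ℓ^r` (even, for `ℓ = 2`), and every such `i` has
  `0 < i < P − 1`, `i + 2 ≤ p + 1` and `P + 1 − i ≤ p + 1`.

## References

* C. Khare, J.-P. Wintenberger, *Serre's modularity conjecture (I)*, Invent. Math. 178 (2009),
  485–504, §8.2 (proof of Theorem 3.2, the inductive step) and §7, (3)–(4). [KhareWintenberger2009]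
-/

namespace Literature.NumberTheory.Automorphic.KhareWintenberger

open Nat

/-! ### Residue classes in intervals -/

/-- Every residue class modulo `M ≥ 1` meets every interval `[lo, hi]` of naturals containing at
least `M` consecutive integers (`lo + M ≤ hi + 1`). [folklore] -/
theorem exists_modEq_mem_Icc {M lo hi : ℕ} (hM : 0 < M) (h : lo + M ≤ hi + 1) (i₀ : ℕ) :
    ∃ i : ℕ, i ≡ i₀ [MOD M] ∧ lo ≤ i ∧ i ≤ hi := by
  obtain ⟨M', rfl⟩ : ∃ M', M = M' + 1 := ⟨M - 1, by omega⟩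
  refine ⟨lo + (i₀ + M' * lo) % (M' + 1), ?_, Nat.le_add_right _ _, ?_⟩
  · have h1 : (lo + (i₀ + M' * lo) % (M' + 1)) % (M' + 1) = (lo + (i₀ + M' * lo)) % (M' + 1) := by
      rw [Nat.add_mod, Nat.mod_mod, ← Nat.add_mod]
    have h2 : lo + (i₀ + M' * lo) = i₀ + lo * (M' + 1) := by ring
    unfold Nat.ModEq
    rw [h1, h2, Nat.add_mul_mod_self_right]
  · have := Nat.mod_lt (i₀ + M' * lo) (show 0 < M' + 1 by omega)
    omega

/-- Parity refinement: for `M` odd, every interval `[lo, hi]` of naturals containing at least `2M`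
consecutive integers contains an EVEN element of any prescribed residue class modulo `M`.
[folklore] -/
theorem exists_even_modEq_mem_Icc {M lo hi : ℕ} (hM : Odd M) (h : lo + 2 * M ≤ hi + 1) (i₀ : ℕ) :
    ∃ i : ℕ, Even i ∧ i ≡ i₀ [MOD M] ∧ lo ≤ i ∧ i ≤ hi := by
  have hM0 : 0 < M := hM.pos
  -- an even representative `c` of the class of `i₀` modulo `M`
  obtain ⟨c, hc, hci⟩ : ∃ c : ℕ, Even c ∧ c ≡ i₀ [MOD M] := by
    rcases Nat.even_or_odd i₀ with he | ho
    · exact ⟨i₀, he, Nat.ModEq.refl _⟩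
    · exact ⟨i₀ + M, ho.add_odd hM, Nat.add_modEq_left_iff.2 dvd_rfl⟩
  obtain ⟨i, hi, hlo, hhi⟩ := exists_modEq_mem_Icc (M := 2 * M) (by omega) h c
  refine ⟨i, ?_, (Nat.ModEq.of_mul_left 2 hi).trans hci, hlo, hhi⟩
  have h2 : i ≡ c [MOD 2] := Nat.ModEq.of_mul_right M hi
  rcases hc with ⟨d, rfl⟩
  refine Nat.even_iff.2 ?_
  have : (d + d) % 2 = 0 := by omega
  unfold Nat.ModEq at h2
  omega

/-! ### The exponent `i` of §8.2 -/

/-- **Khare–Wintenberger (I), §8.2, choice of `i` when `ℓ > 2`.**  Let `ℓ = 2m + 1` (`m ≥ 1`),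
`P − 1 = ℓ^r · M` (`r ≥ 1`, `M ≥ 1`; so `M = (P−1)/ℓ^r` when `ℓ^r ∥ P − 1`), and assume estimate
(3): `(m+1)(P−1) + 2(2m+1) ≤ (2m+1)(p+1)`.  Then every residue class modulo `M` (the class of
exponents `i` for which `ω_P^i` has a prescribed reduction modulo `ℓ`) contains an `i` in the
printed interval `[(m/(2m+1))(P−1), ((m+1)/(2m+1))(P−1)]`, i.e. `m(P−1) ≤ ℓ i ≤ (m+1)(P−1)`; any
such `i` satisfies `0 < i < P − 1` (so `χ' = ω_P^i` is non-trivial, `0 < i ≤ P − 2`) and both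
candidate Serre weights of Theorem 5.1 (3) are at most `p + 1`: `i + 2 ≤ p + 1` and
`P + 1 − i ≤ p + 1`. [cite: KhareWintenberger2009, §8.2 (inductive step) with §7 (3)] -/
theorem exists_exponent_odd {p P m r M : ℕ} (hm : 1 ≤ m) (hr : 1 ≤ r) (hM : 1 ≤ M)
    (hPM : P - 1 = (2 * m + 1) ^ r * M)
    (h3 : (m + 1) * (P - 1) + 2 * (2 * m + 1) ≤ (2 * m + 1) * (p + 1)) (i₀ : ℕ) :
    ∃ i : ℕ, i ≡ i₀ [MOD M] ∧ m * (P - 1) ≤ (2 * m + 1) * i ∧ (2 * m + 1) * i ≤ (m + 1) * (P - 1) ∧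
      0 < i ∧ i < P - 1 ∧ i + 2 ≤ p + 1 ∧ P + 1 ≤ p + 1 + i := by
  obtain ⟨j, rfl⟩ : ∃ j, r = j + 1 := ⟨r - 1, by omega⟩
  set ℓ : ℕ := 2 * m + 1 with hℓ
  set a : ℕ := P - 1 with ha
  -- the interval `[m ℓ^j M, (m+1) ℓ^j M]` has `ℓ^j M + 1 ≥ M` integers
  have hℓj : 1 ≤ ℓ ^ j := Nat.one_le_pow _ _ (by omega)
  have hlen : m * (ℓ ^ j * M) + M ≤ (m + 1) * (ℓ ^ j * M) + 1 := by
    have : M ≤ ℓ ^ j * M := Nat.le_mul_of_pos_left M hℓj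
    nlinarith
  obtain ⟨i, hi, hlo, hhi⟩ := exists_modEq_mem_Icc (lo := m * (ℓ ^ j * M))
    (hi := (m + 1) * (ℓ ^ j * M)) (by omega) hlen i₀
  have haM : a = ℓ * (ℓ ^ j * M) := by rw [hPM, pow_succ]; ring
  have hlo' : m * a ≤ ℓ * i := by
    rw [haM]
    calc m * (ℓ * (ℓ ^ j * M)) = ℓ * (m * (ℓ ^ j * M)) := by ring
      _ ≤ ℓ * i := Nat.mul_le_mul_left _ hlo
  have hhi' : ℓ * i ≤ (m + 1) * a := by
    rw [haM]
    calc ℓ * i ≤ ℓ * ((m + 1) * (ℓ ^ j * M)) := Nat.mul_le_mul_left _ hhi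
      _ = (m + 1) * (ℓ * (ℓ ^ j * M)) := by ring
  have hMpos : 0 < ℓ ^ j * M := Nat.mul_pos (by omega) (by omega)
  have ha0 : 0 < a := by
    rw [haM]; exact Nat.mul_pos (by omega) hMpos
  refine ⟨i, hi, hlo', hhi', ?_, ?_, ?_, ?_⟩
  · -- `0 < i` as `lo ≥ 1`
    have : 0 < m * (ℓ ^ j * M) := Nat.mul_pos (by omega) hMpos
    exact lt_of_lt_of_le this hlo
  · -- `i < a` as `ℓ i ≤ (m+1) a < ℓ a`
    have h1 : (m + 1) * a < ℓ * a := Nat.mul_lt_mul_of_pos_right (by omega) ha0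
    have h2 : ℓ * i < ℓ * a := lt_of_le_of_lt hhi' h1
    exact Nat.lt_of_mul_lt_mul_left h2
  · -- `ℓ (i + 2) ≤ (m+1) a + 2ℓ ≤ ℓ (p + 1)`
    have h1 : ℓ * (i + 2) ≤ ℓ * (p + 1) := by
      calc ℓ * (i + 2) = ℓ * i + 2 * ℓ := by ring
        _ ≤ (m + 1) * a + 2 * ℓ := Nat.add_le_add_right hhi' _
        _ ≤ ℓ * (p + 1) := h3
    exact Nat.le_of_mul_le_mul_left h1 (by omega)
  · -- `ℓ (P + 1) = m a + (m+1) a + 2ℓ ≤ ℓ i + ℓ (p+1)`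
    have hP : P = a + 1 := by omega
    have h1 : ℓ * (P + 1) ≤ ℓ * (p + 1 + i) := by
      calc ℓ * (P + 1) = m * a + ((m + 1) * a + 2 * ℓ) := by rw [hP, hℓ]; ring
        _ ≤ ℓ * i + ℓ * (p + 1) := Nat.add_le_add hlo' h3
        _ = ℓ * (p + 1 + i) := by ring
    exact Nat.le_of_mul_le_mul_left h1 (by omega)

/-- **Khare–Wintenberger (I), §8.2, choice of `i` when `ℓ = 2`.**  Let `P − 1 = 2^r · M` with
`r ≥ 4` and `M` odd (so `M = (P−1)/2^r`, `2^r ∥ P − 1`), and assume estimate (4):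
`(2^{r−1}+2)(P−1) + 2^{r+1} ≤ 2^r (p+1)`.  Then every residue class modulo `M` contains an EVEN `i`
in the printed interval `[(1/2)(P−1), ((2^{r−1}+2)/2^r)(P−1)]`, i.e.
`P − 1 ≤ 2 i` and `2^r i ≤ (2^{r−1}+2)(P−1)`; any such `i` satisfies `0 < i < P − 1` and
`i + 2 ≤ p + 1`, `P + 1 − i ≤ p + 1`. [cite: KhareWintenberger2009, §8.2 (inductive step) with §7 (4)] -/
theorem exists_exponent_two {p P r M : ℕ} (hr : 4 ≤ r) (hM : Odd M) (hPM : P - 1 = 2 ^ r * M)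
    (h4 : (2 ^ (r - 1) + 2) * (P - 1) + 2 ^ (r + 1) ≤ 2 ^ r * (p + 1)) (i₀ : ℕ) :
    ∃ i : ℕ, Even i ∧ i ≡ i₀ [MOD M] ∧ P - 1 ≤ 2 * i ∧ 2 ^ r * i ≤ (2 ^ (r - 1) + 2) * (P - 1) ∧
      0 < i ∧ i < P - 1 ∧ i + 2 ≤ p + 1 ∧ P + 1 ≤ p + 1 + i := by
  obtain ⟨j, rfl⟩ : ∃ j, r = j + 1 := ⟨r - 1, by omega⟩
  simp only [Nat.add_sub_cancel] at h4 ⊢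
  have hM0 : 0 < M := hM.pos
  have ht8 : 8 ≤ 2 ^ j := by
    calc (8 : ℕ) = 2 ^ 3 := by norm_num
      _ ≤ 2 ^ j := Nat.pow_le_pow_right (by norm_num) (by omega)
  have h2t : 2 ^ (j + 1) = 2 * 2 ^ j := by rw [pow_succ]; ring
  have h4t : 2 ^ (j + 1 + 1) = 4 * 2 ^ j := by rw [pow_succ, pow_succ]; ring
  rw [h2t, h4t] at h4
  rw [h2t] at hPM ⊢
  set a : ℕ := P - 1 with ha
  -- the interval `[2^j M, (2^j + 2) M]`, of `2M + 1` integers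
  have hlen : 2 ^ j * M + 2 * M ≤ (2 ^ j + 2) * M + 1 := by nlinarith
  obtain ⟨i, hev, hi, hlo, hhi⟩ := exists_even_modEq_mem_Icc (lo := 2 ^ j * M)
    (hi := (2 ^ j + 2) * M) hM hlen i₀
  have hlo' : a ≤ 2 * i := by rw [hPM]; nlinarith
  have hhi' : 2 * 2 ^ j * i ≤ (2 ^ j + 2) * a := by
    rw [hPM]
    calc 2 * 2 ^ j * i ≤ 2 * 2 ^ j * ((2 ^ j + 2) * M) := Nat.mul_le_mul_left _ hhi
      _ = (2 ^ j + 2) * (2 * 2 ^ j * M) := by ring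
  have ha0 : 0 < a := by rw [hPM]; positivity
  refine ⟨i, hev, hi, hlo', hhi', ?_, ?_, ?_, ?_⟩
  · have : 0 < 2 ^ j * M := Nat.mul_pos (by omega) hM0
    exact lt_of_lt_of_le this hlo
  · -- `i ≤ (2^j+2) M < 2 · 2^j · M = a`
    have hlt : (2 ^ j + 2) * M < 2 * 2 ^ j * M := Nat.mul_lt_mul_of_pos_right (by omega) hM0
    calc i ≤ (2 ^ j + 2) * M := hhi
      _ < 2 * 2 ^ j * M := hlt
      _ = a := hPM.symm
  · -- `2·2^j (i+2) ≤ (2^j+2) a + 4·2^j ≤ 2·2^j (p+1)`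
    have h1 : 2 * 2 ^ j * (i + 2) ≤ 2 * 2 ^ j * (p + 1) := by
      calc 2 * 2 ^ j * (i + 2) = 2 * 2 ^ j * i + 4 * 2 ^ j := by ring
        _ ≤ (2 ^ j + 2) * a + 4 * 2 ^ j := Nat.add_le_add_right hhi' _
        _ ≤ 2 * 2 ^ j * (p + 1) := h4
    exact Nat.le_of_mul_le_mul_left h1 (by positivity)
  · -- `2·2^j (P+1) = 2·2^j a + 4·2^j ≤ (2^j+2) a + 4·2^j + 2^j a ≤ 2·2^j (p+1) + 2·2^j i`
    have hP : P = a + 1 := by omega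
    have hta : 2 ^ j * a ≤ 2 * 2 ^ j * i := by
      calc 2 ^ j * a ≤ 2 ^ j * (2 * i) := Nat.mul_le_mul_left _ hlo'
        _ = 2 * 2 ^ j * i := by ring
    have h1 : 2 * 2 ^ j * (P + 1) ≤ 2 * 2 ^ j * (p + 1 + i) := by
      calc 2 * 2 ^ j * (P + 1) = 2 * 2 ^ j * a + 4 * 2 ^ j := by rw [hP]; ring
        _ ≤ ((2 ^ j + 2) * a + 4 * 2 ^ j) + 2 ^ j * a := by nlinarith
        _ ≤ 2 * 2 ^ j * (p + 1) + 2 * 2 ^ j * i := Nat.add_le_add h4 hta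
        _ = 2 * 2 ^ j * (p + 1 + i) := by ring
    exact Nat.le_of_mul_le_mul_left h1 (by positivity)

end Literature.NumberTheory.Automorphic.KhareWintenberger
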